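import Mathlib
import Summits.NavierStokesRegularity.NavierStokesRegularity.Theorems.FrozenSignCascadeEnvelopeBoundStubEnergyOfUnique
import Literature.Analysis.FluidPDE.NSKatoToClayHolds
import Literature.Analysis.FluidPDE.KatoMaximalTime
import HarnessLib

/-!
# Route FrozenSignCascade · crux `EnvelopeBound` (stmt-NavierStokesRegularity-1549): Fourier-mild
  solutions of every length below a Kato solution

Support file for the crux item stmt-NavierStokesRegularity-1549 (`EnvelopeBound`, rank 2 of route
`FrozenSignCascade`); lands `--supports` that item (line `registered`, lead c5). Companion:
`FrozenSignCascadeEnvelopeBoundKato` (the envelope bound below `T_max`; the crux from global Kato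
regularity).

**What is proved.** `exists_fourierMild_of_isKatoSolutionOn` — the FOURIER SIDE of the tree's
unconditional restart induction
`Literature.Analysis.FluidPDE.exists_isTaoSolutionOn_of_hasGlobalKatoSolution'`
(`NSKatoToClayHolds`), run from a Kato solution `w ∈ C([0,T'); L³)` of the Clay datum `u₀` rather
than from a global one: for every `0 < T < T'` there are a Tao-class solution `(u, p)` on `[0, T]`
AND a Fourier-side mild solution `V` on `[0, T]` (`FourierNS.IsFourierMild (4π²ν) 4 0 T V`) with
`u t = synthVel (V t)` on `[0, T]` and `V 0 = FourierNS.fourierData hu hd`. The induction state of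
the Literature proof already carries `V` (physical pieces glued by `IsTaoSolutionOn.glue`, Fourier
pieces by `IsFourierMild.glue`); its last line discards it. The proof below is that proof with the
state exported and the Kato hypothesis localised to `[0, T')` (the `L³`-small-plus-bounded splitting
needs `C([0,T_w]; L³)` on a closed slab `T < T_w < T'` only) — adapted from
`Literature/Analysis/FluidPDE/NSKatoToClayHolds.lean`; no new mathematics is claimed.
Corollaries: the literal-`4` form (`exists_fourierMild_four_of_isKatoSolutionOn`, via the landed
`Registered.isFourierMild_four`) and the global form from `HasGlobalKatoSolution`
(`exists_fourierMild_of_hasGlobalKatoSolution`), which is exactly the hypothesis of the landed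
`Registered.envelopeBound_of_globalMild` (p155124), now derived from the programme's Kato currency.

References: T. Kato, Math. Z. 187 (1984), Thms. 1, 4; W. von Wahl (1985) as in
P. G. Lemarié-Rieusset, *The Navier–Stokes Problem in the 21st Century* (2016), Prop. 12.3 with
Thm. 7.2 (`C([0,T];L³)` is a regularity class; restart of mild solutions); J. Leray, Acta Math. 63
(1934) §§19–21 (regular solution, doubling/restart argument).
-/

noncomputable section

set_option linter.dupNamespace false -- nested layout Summit.<S>.<Sub>, Sub = S (D-0017)

open MeasureTheory Set Function Filter Topology Real Complex FourierTransform InnerProductSpace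
open scoped ENNReal NNReal ContDiff FourierTransform ComplexConjugate Laplacian
open Literature.Analysis.FluidPDE Literature.Analysis.FluidPDE.FourierNS

namespace Summit.NavierStokesRegularity.NavierStokesRegularity.Theorems.EnvelopeBound.Kato

/-! ### The Fourier side of the restart induction along a Kato solution -/

-- adapted from Literature/Analysis/FluidPDE/NSKatoToClayHolds.lean
-- (`exists_isTaoSolutionOn_of_hasGlobalKatoSolution'`): same proof, Kato hypothesis localised to
-- `[0, T')`, induction state `(u, p, V)` exported instead of `(u, p)`.
/-- **Tao-class AND Fourier-mild solutions of every length below a Kato solution.** Let `ν > 0`,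
let `u₀` be a Clay datum (smooth, divergence free, rapidly decaying) and let `w` be a Kato solution
(`IsKatoSolutionOn T' ν u₀ w`: mild, `C([0,T'); L³)`, measurable) from `u₀` on `[0, T')`. Then for
every `0 < T < T'` there are a Tao-class solution `(u, p)` from `u₀` on `[0, T]` and a Fourier-side
mild solution `V` on `[0, T]` with heat rate `4π²ν` and weight order `card (Fin 3) + 1 = 4`,
synthesising to `u` at every time of `[0, T]` and issued from the Fourier datum
`fourierData hu hd`. Proof: the restart induction of
`exists_isTaoSolutionOn_of_hasGlobalKatoSolution'` (Fourier–Picard pieces of uniform length, the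
order-`4` weights being controlled by energy and `L²_t H²_x` dissipation, which the enstrophy
inequality under the `L³`-small-plus-bounded splitting along `w` bounds in terms of `u₀`; physical
glue `IsTaoSolutionOn.glue`, Fourier glue `IsFourierMild.glue`), with its state exported.
[cite: LemarieRieusset2016, Prop. 12.3 (von Wahl) with Thm. 7.2] -/
theorem exists_fourierMild_of_isKatoSolutionOn {ν : ℝ} (hν : 0 < ν)
    {u₀ : EuclideanSpace ℝ (Fin 3) → EuclideanSpace ℝ (Fin 3)} (hsm : ContDiff ℝ ∞ u₀)
    (hdiv : NSWave0.IsDivFree u₀) (hdec : HasRapidSpatialDecay u₀)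
    {T' : ℝ} {w : ℝ → EuclideanSpace ℝ (Fin 3) → EuclideanSpace ℝ (Fin 3)}
    (hw : IsKatoSolutionOn T' ν u₀ w) {Tt : ℝ} (hTt : 0 < Tt) (hTT' : Tt < T') :
    ∃ (u : ℝ → EuclideanSpace ℝ (Fin 3) → EuclideanSpace ℝ (Fin 3))
      (p : ℝ → EuclideanSpace ℝ (Fin 3) → ℝ) (V : ℝ → EuclideanSpace ℝ (Fin 3) → Fin 3 → ℂ),
      IsTaoSolutionOn Tt ν u₀ u p ∧
      IsFourierMild (4 * π ^ 2 * ν) (Fintype.card (Fin 3) + 1) 0 Tt V ∧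
      (∀ t ∈ Icc 0 Tt, u t = synthVel (V t)) ∧ V 0 = fourierData hsm hdec := by

  /- the working horizon `Tw`, strictly between `Tt` and the Kato lifespan `T'` -/
  set Tw : ℝ := (Tt + T') / 2 with hTw
  have hTtw : Tt < Tw := by rw [hTw]; linarith
  have hTwT' : Tw < T' := by rw [hTw]; linarith
  have hTw0 : 0 < Tw := hTt.trans hTtw
  /- the Kato solution, restricted to the closed slabs `[0, F]`, `F ≤ Tw` -/
  have hwmild : ∀ ⦃F : ℝ⦄, F ≤ Tw → IsMildNSSolutionOn (Ico 0 F) ν 0 u₀ w := fun F hF =>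
    hw.mild.mono (Ico_subset_Ico_right (hF.trans hTwT'.le))
  have hwc : ∀ ⦃F : ℝ⦄, F ≤ Tw → ContinuousInLpOn (Icc 0 F) 3 w := fun F hF =>
    hw.continuousInLpOn.mono (Icc_subset_Ico_right (lt_of_le_of_lt hF hTwT'))
  have hwm : ∀ ⦃F : ℝ⦄, F ≤ Tw →
      AEStronglyMeasurable (uncurry w) (volume.restrict (Ioo 0 F ×ˢ univ)) := fun F hF =>
    hw.aestronglyMeasurable.mono_measure
      (Measure.restrict_mono (prod_mono (Ioo_subset_Ioo_right (hF.trans hTwT'.le)) subset_rfl)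
        le_rfl)
  /- the splitting threshold `8 (δK)² ≤ ν²` and the `L³` tails of `w` on `[0, Tw]` -/
  set Ks : ℝ := (SNormLESNormFDerivOfEqConst (EuclideanSpace ℝ (Fin 3))
    (volume : Measure (EuclideanSpace ℝ (Fin 3))) 2 : ℝ) with hKs
  have hKs0 : 0 ≤ Ks := NNReal.coe_nonneg _
  set δ : ℝ := ν / (4 * (Ks + 1)) with hδdef
  have hδ0 : 0 < δ := by positivity
  have hδK : δ * Ks ≤ ν / 4 := by
    rw [hδdef, div_mul_eq_mul_div, div_le_div_iff₀ (by positivity) (by positivity)]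
    nlinarith [hν]
  have hδ8 : 8 * (δ * Ks) ^ 2 ≤ ν ^ 2 := by nlinarith [hδK, mul_nonneg hδ0.le hKs0]
  have hδ2 : 2 * (δ * Ks) ^ 2 ≤ ν ^ 2 := by nlinarith [hδ8, sq_nonneg (δ * Ks)]
  obtain ⟨lam, hlam⟩ := (hwc le_rfl).exists_forall_eLpNorm_indicator_le
    isCompact_Icc (by norm_num : (1 : ℝ≥0∞) ≤ 3) (by norm_num) hδ0
  set M : ℝ := max (lam : ℝ) 1 with hM
  have hMpos : 0 < M := lt_of_lt_of_le one_pos (le_max_right _ _)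
  /- energy and enstrophy of the datum -/
  set e₀ : ℝ := 2 * VectorCalculus.kineticEnergy u₀ with he₀
  have he₀0 : 0 ≤ e₀ := mul_nonneg zero_le_two (kineticEnergy_nonneg _)
  have hHinf : ∀ n : ℕ, ∫⁻ x, ‖iteratedFDeriv ℝ n u₀ x‖ₑ ^ 2 < ⊤ :=
    hdec.lintegral_enorm_iteratedFDeriv_sq_lt_top
  have hG₀ : ∫⁻ x, ENNReal.ofReal (frobeniusNormSq (fderiv ℝ u₀ x)) < ⊤ := by
    calc ∫⁻ x, ENNReal.ofReal (frobeniusNormSq (fderiv ℝ u₀ x))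
        ≤ ∫⁻ x, 3 * ‖iteratedFDeriv ℝ 1 u₀ x‖ₑ ^ 2 := lintegral_mono fun x => by
          rw [← ofReal_norm, norm_iteratedFDeriv_one, ofReal_norm]
          exact ofReal_frobeniusNormSq_le_three_mul_enorm_sq _
      _ = 3 * ∫⁻ x, ‖iteratedFDeriv ℝ 1 u₀ x‖ₑ ^ 2 := lintegral_const_mul' _ _ (by simp)
      _ < ⊤ := ENNReal.mul_lt_top (by simp) (hHinf 1)
  set g₀ : ℝ := (∫⁻ x, ENNReal.ofReal (frobeniusNormSq (fderiv ℝ u₀ x))).toReal with hg₀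
  have hg₀0 : 0 ≤ g₀ := ENNReal.toReal_nonneg
  have hg₀eq : ∫⁻ x, ENNReal.ofReal (frobeniusNormSq (fderiv ℝ u₀ x)) = ENNReal.ofReal g₀ := by
    rw [hg₀, ENNReal.ofReal_toReal hG₀.ne]
  /- the dissipation budget -/
  set κw : ℝ := ν⁻¹ * (1 + 4 * M ^ 2 * Tw / ν * Real.exp (2 * M ^ 2 * Tw / ν)) with hκw
  have hκw0 : 0 ≤ κw := by positivity
  set D : ℝ := ((2 * π) ^ 4)⁻¹ * (κw * g₀) with hD
  have hD0 : 0 ≤ D := by positivity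
  /- the heat rate, the order, the window, the initial Fourier datum -/
  set cF : ℝ := 4 * π ^ 2 * ν with hcF
  have hcF0 : 0 < cF := by positivity
  have hι : Fintype.card (Fin 3) < 4 := by simp
  obtain ⟨τw, hτw, hwindow⟩ := exists_window_of_energy_dissip (ι := Fin 3) hι hcF0
    (Fintype.card (Fin 3) + 1) he₀0 hD0
  set a₀ : EuclideanSpace ℝ (Fin 3) → Fin 3 → ℂ := fourierData hsm hdec with ha₀
  obtain ⟨A₀, hA₀⟩ := hasDecay_fourierData hsm hdec (Fintype.card (Fin 3) + 1)
  have hA₀0 : 0 ≤ A₀ := hA₀.nonneg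
  set Aunif : ℝ := 2 ^ ⌈Tw / τw⌉₊ * A₀ with hAunif
  have hAunif0 : 0 ≤ Aunif := by positivity
  set TP : ℝ := picardTime (Fin 3) cF (Fintype.card (Fin 3) + 1) (2 * Aunif) with hTP
  have hTPpos : 0 < TP := picardTime_pos hcF0 _ _ (by positivity)
  have hdiv' : ∀ ξ : EuclideanSpace ℝ (Fin 3), ∑ l, (ξ l : ℂ) * a₀ ξ l = 0 :=
    sum_mul_fourierData hsm hdec hdiv
  have hconj₀ : ∀ ξ l, a₀ (-ξ) l = conj (a₀ ξ l) := fourierData_conj_symm hsm hdec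
  have hsynth₀ : synthVel a₀ = u₀ := by
    funext x
    ext l
    rw [synthVel_apply, show (fun ξ => a₀ ξ l) = fun ξ => fourierData hsm hdec ξ l from rfl,
      fourier_fourierData hsm hdec l]
    simp
  /- the state of the induction -/
  set State : ℝ → (ℝ → EuclideanSpace ℝ (Fin 3) → EuclideanSpace ℝ (Fin 3)) →
      (ℝ → EuclideanSpace ℝ (Fin 3) → ℝ) → (ℝ → EuclideanSpace ℝ (Fin 3) → Fin 3 → ℂ) → Prop :=
    fun F u p V => IsTaoSolutionOn F ν u₀ u p ∧
      IsFourierMild cF (Fintype.card (Fin 3) + 1) 0 F V ∧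
      (∀ t ∈ Icc 0 F, u t = synthVel (V t)) ∧ V 0 = a₀ with hState
  /- uniform bounds for a state on `[0, F]`, `F ≤ Tw`: energy, dissipation, weights -/
  have hbounds : ∀ ⦃F : ℝ⦄ ⦃u : ℝ → EuclideanSpace ℝ (Fin 3) → EuclideanSpace ℝ (Fin 3)⦄
      ⦃p : ℝ → EuclideanSpace ℝ (Fin 3) → ℝ⦄ ⦃V : ℝ → EuclideanSpace ℝ (Fin 3) → Fin 3 → ℂ⦄,
      0 < F → F ≤ Tw → State F u p V →
        ∀ t' ∈ Icc 0 F, HasDecay (Fintype.card (Fin 3) + 1) Aunif (V t') := by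
    intro F u p V hF hFw hS t' ht'
    obtain ⟨h, hV, hsyn, hV0⟩ := hS
    -- identification with the Kato solution and the `L³` tails
    have hae : ∀ s ∈ Icc 0 F, u s =ᵐ[volume] w s :=
      h.ae_eq_of_kato_Icc hν hF (hwmild hFw) (hwc hFw) (hwm hFw)
    have htail : ∀ s ∈ Icc 0 F,
        eLpNorm ({x | lam ≤ ‖w s x‖₊}.indicator (w s)) 3 volume ≤ ENNReal.ofReal δ :=
      fun s hs => hlam s ⟨hs.1, hs.2.trans hFw⟩
    -- energy of the Fourier side
    have hE : ∀ r ∈ Icc 0 F, ∫⁻ η, ‖V r η‖ₑ ^ 2 ≤ ENNReal.ofReal e₀ := by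
      intro r hr
      have hdecr : ∀ K : ℕ, ∃ B, HasDecay K B (V r) := fun K => by
        obtain ⟨B, hB⟩ := hV.decay K
        exact ⟨B, hB r⟩
      calc ∫⁻ η, ‖V r η‖ₑ ^ 2 ≤ ∫⁻ x, ‖synthVel (V r) x‖ₑ ^ 2 :=
            lintegral_enorm_sq_le_of_synthVel (V r) (hV.continuous_slice r) hdecr
              (fun ξ l => hV.conjSymm r ξ l)
        _ = ∫⁻ x, ‖u r x‖ₑ ^ 2 := by rw [hsyn r hr]
        _ ≤ ENNReal.ofReal e₀ := h.lintegral_enorm_sq_le hF hν.le hr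
    -- dissipation of the Fourier side
    have hDis : dissip V 0 F ≤ ENNReal.ofReal D := by
      have h1 : ∀ r ∈ Icc 0 F, ∫⁻ x, ‖iteratedFDeriv ℝ 1 (u r) x‖ₑ ^ 2 < ⊤ := fun r hr =>
        (h.slice hr).2.2 1
      have h2 : ∀ r ∈ Icc 0 F, ∫⁻ x, ‖iteratedFDeriv ℝ 2 (u r) x‖ₑ ^ 2 < ⊤ := fun r hr =>
        (h.slice hr).2.2 2
      have h3 : ∀ r ∈ Icc 0 F, ∫⁻ x, ‖iteratedFDeriv ℝ 3 (u r) x‖ₑ ^ 2 < ⊤ := fun r hr =>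
        (h.slice hr).2.2 3
      have hdis := hV.dissip_le_of_synthVel hsyn (fun r hr => (h.slice hr).1) h1 h2 h3 le_rfl le_rfl
      have hlap := h.lintegral_laplacian_sq_le_of_tails hν hF hae hδ0.le hδ8 htail
      have hIoc : ∫⁻ r in Ioc 0 F, ∫⁻ x, ‖(Δ (u r)) x‖ₑ ^ 2 =
          ∫⁻ r in Ioo 0 F, ∫⁻ x, ‖(Δ (u r)) x‖ₑ ^ 2 := setLIntegral_congr Ioo_ae_eq_Ioc.symm
      have hκle : ν⁻¹ * (1 + 4 * M ^ 2 * F / ν * Real.exp (2 * M ^ 2 * F / ν)) ≤ κw := by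
        rw [hκw]
        refine mul_le_mul_of_nonneg_left ?_ (by positivity)
        have hexp : Real.exp (2 * M ^ 2 * F / ν) ≤ Real.exp (2 * M ^ 2 * Tw / ν) :=
          Real.exp_le_exp.2 (div_le_div_of_nonneg_right
            (mul_le_mul_of_nonneg_left hFw (by positivity)) hν.le)
        have h4 : 4 * M ^ 2 * F / ν ≤ 4 * M ^ 2 * Tw / ν :=
          div_le_div_of_nonneg_right (mul_le_mul_of_nonneg_left hFw (by positivity)) hν.le
        have h5 : 0 ≤ 4 * M ^ 2 * F / ν := by positivity
        nlinarith [mul_le_mul h4 hexp (Real.exp_nonneg _) (h5.trans h4), Real.exp_nonneg (2 * M ^ 2 * F / ν)]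
      calc dissip V 0 F ≤ ENNReal.ofReal (((2 * π) ^ 4)⁻¹) *
            ∫⁻ r in Ioc 0 F, ∫⁻ x, ‖(Δ (u r)) x‖ₑ ^ 2 := hdis
        _ ≤ ENNReal.ofReal (((2 * π) ^ 4)⁻¹) * (ENNReal.ofReal κw * ENNReal.ofReal g₀) := by
            rw [hIoc, ← hg₀eq]
            gcongr
            exact hlap.trans (mul_le_mul_of_nonneg_right (ENNReal.ofReal_le_ofReal hκle) bot_le)
        _ = ENNReal.ofReal D := by
            rw [hD, ← ENNReal.ofReal_mul hκw0, ← ENNReal.ofReal_mul (by positivity)]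
    -- the doubling argument
    have hVA₀ : HasDecay (Fintype.card (Fin 3) + 1) A₀ (V 0) := by rw [hV0]; exact hA₀
    have hdecay := hwindow hV hE hDis hVA₀ t' ht'
    rw [sub_zero] at hdecay
    refine hdecay.mono (mul_le_mul_of_nonneg_right ?_ hA₀0)
    exact pow_le_pow_right₀ one_le_two (Nat.ceil_le_ceil (div_le_div_of_nonneg_right hFw hτw.le))
  /- the restart step -/
  have hstep : ∀ ⦃F : ℝ⦄ ⦃u : ℝ → EuclideanSpace ℝ (Fin 3) → EuclideanSpace ℝ (Fin 3)⦄
      ⦃p : ℝ → EuclideanSpace ℝ (Fin 3) → ℝ⦄ ⦃V : ℝ → EuclideanSpace ℝ (Fin 3) → Fin 3 → ℂ⦄,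
      0 < F → F ≤ Tt → State F u p V →
      ∃ (F' : ℝ) (u' : ℝ → EuclideanSpace ℝ (Fin 3) → EuclideanSpace ℝ (Fin 3))
        (p' : ℝ → EuclideanSpace ℝ (Fin 3) → ℝ) (V' : ℝ → EuclideanSpace ℝ (Fin 3) → Fin 3 → ℂ),
        (Tw ≤ F' ∨ F + TP / 2 ≤ F') ∧ F' ≤ Tw ∧ 0 < F' ∧ State F' u' p' V' := by
    intro F u p V hF hFT hS
    have hFw : F ≤ Tw := hFT.trans hTtw.le
    have hdecay := hbounds hF hFw hS
    obtain ⟨h, hV, hsyn, hV0⟩ := hS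
    set t' : ℝ := max (F / 2) (F - TP / 4) with ht'
    have ht'0 : 0 ≤ t' := le_max_of_le_left (by linarith)
    have ht'F : t' < F := max_lt (by linarith) (by linarith)
    have hFt' : F ≤ t' + TP := by linarith [le_max_right (F / 2) (F - TP / 4)]
    have ht'I : t' ∈ Icc 0 F := ⟨ht'0, ht'F.le⟩
    -- the restart piece from the Fourier-side state `V t'`
    have hdecAll : ∀ K : ℕ, ∃ B, HasDecay K B (V t') := fun K => by
      obtain ⟨B, hB⟩ := hV.decay K
      exact ⟨B, hB t'⟩
    obtain ⟨v, q, W, hv, hW, hvsyn, hW0⟩ := exists_isTaoSolutionOn_fourierPiece hν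
      (hV.continuous_slice t') hdecAll (hdecay t' ht'I) (hV.divFree t') (hV.conjSymm t')
    rw [← hcF, ← hTP] at hv hW
    have hvt' : synthVel (V t') = u t' := (hsyn t' ht'I).symm
    rw [hvt'] at hv
    -- the physical glue
    have hglue := h.glue hv hν hTPpos ht'0 ht'F hFt'
    -- the agreement on the overlap
    have hagree : ∀ s ∈ Ico 0 (min (F - t') TP), u (s + t') = v s :=
      (h.translate ht'0 ht'F).eq_of_isTaoSolutionOn hv hν (by linarith) hTPpos
    -- the Fourier glue
    have hW' : IsFourierMild cF (Fintype.card (Fin 3) + 1) t' (t' + TP) (fun t => W (t - t')) := by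
      have := hW.translate t'
      simpa only [zero_add, add_comm TP t'] using this
    have hVt' : IsFourierMild cF (Fintype.card (Fin 3) + 1) 0 t' V := hV.mono le_rfl ht'0 ht'F.le
    have hjunction : V t' = (fun t => W (t - t')) t' := by simp only [sub_self, hW0]
    have hGlueF := hVt'.glue hW' hjunction
    set F' : ℝ := min (t' + TP) Tw with hF'
    have hF'pos : 0 < F' := lt_min (by linarith) hTw0
    have hF'le : F' ≤ t' + TP := min_le_left _ _
    refine ⟨F', (fun t => if t < F then u t else v (t - t')),
      (fun t => if t < F then p t else q (t - t')), (fun t => if t ≤ t' then V t else W (t - t')),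
      ?_, min_le_right _ _, hF'pos, ?_, ?_, ?_, ?_⟩
    · by_cases hcase : t' + TP ≤ Tw
      · right; rw [hF', min_eq_left hcase]; linarith [le_max_right (F / 2) (F - TP / 4)]
      · left; rw [hF', min_eq_right (le_of_not_ge hcase)]
    · exact hglue.mono hF'pos hF'le
    · exact hGlueF.mono le_rfl hF'pos.le hF'le
    · -- synthesis at every time of `[0, F']`
      intro t ht
      by_cases htt' : t ≤ t'
      · have htF : t < F := lt_of_le_of_lt htt' ht'F
        simp only [if_pos htF, if_pos htt']
        exact hsyn t ⟨ht.1, htF.le⟩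
      · have hgt : t' < t := not_le.1 htt'
        simp only [if_neg htt']
        by_cases htF : t < F
        · simp only [if_pos htF]
          have hs : t - t' ∈ Ico 0 (min (F - t') TP) :=
            ⟨by linarith, lt_min (by linarith) (by linarith [ht.2])⟩
          have := hagree (t - t') hs
          rw [sub_add_cancel] at this
          rw [this, hvsyn]
        · simp only [if_neg htF]
          exact hvsyn (t - t')
    · -- the initial Fourier datum is unchanged
      show (if (0 : ℝ) ≤ t' then V 0 else W (0 - t')) = a₀
      rw [if_pos ht'0, hV0]
  /- the first state, from the Schwartz datum -/
  have hbase : ∃ (F : ℝ) (u : ℝ → EuclideanSpace ℝ (Fin 3) → EuclideanSpace ℝ (Fin 3))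
      (p : ℝ → EuclideanSpace ℝ (Fin 3) → ℝ) (V : ℝ → EuclideanSpace ℝ (Fin 3) → Fin 3 → ℂ),
      0 < F ∧ F ≤ Tw ∧ State F u p V := by
    obtain ⟨u, p, V, hu, hV, hsyn, hV0⟩ := exists_isTaoSolutionOn_fourierPiece hν
      (continuous_fourierData hsm hdec) (hasDecay_fourierData hsm hdec) hA₀ hdiv' hconj₀
    rw [hsynth₀] at hu
    set T₀ : ℝ := picardTime (Fin 3) (4 * π ^ 2 * ν) (Fintype.card (Fin 3) + 1) (2 * A₀) with hT₀
    have hT₀pos : 0 < T₀ := picardTime_pos hcF0 _ _ (by positivity)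
    set F₀ : ℝ := min T₀ Tw with hF₀
    have hF₀pos : 0 < F₀ := lt_min hT₀pos hTw0
    refine ⟨F₀, u, p, V, hF₀pos, min_le_right _ _, ?_, ?_, ?_, hV0⟩
    · exact hu.mono hF₀pos (min_le_left _ _)
    · exact hV.mono le_rfl hF₀pos.le (min_le_left _ _)
    · exact fun t _ => hsyn t
  /- the induction -/
  have hiter : ∀ k : ℕ, ∃ (F : ℝ) (u : ℝ → EuclideanSpace ℝ (Fin 3) → EuclideanSpace ℝ (Fin 3))
      (p : ℝ → EuclideanSpace ℝ (Fin 3) → ℝ) (V : ℝ → EuclideanSpace ℝ (Fin 3) → Fin 3 → ℂ),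
      0 < F ∧ F ≤ Tw ∧ State F u p V ∧ (Tt ≤ F ∨ (k : ℝ) * (TP / 2) ≤ F) := by
    intro k
    induction k with
    | zero =>
      obtain ⟨F, u, p, V, hF, hFw, hS⟩ := hbase
      exact ⟨F, u, p, V, hF, hFw, hS, Or.inr (by simpa using hF.le)⟩
    | succ k ih =>
      obtain ⟨F, u, p, V, hF, hFw, hS, halt⟩ := ih
      rcases le_or_gt Tt F with hdone | hlt
      · exact ⟨F, u, p, V, hF, hFw, hS, Or.inl hdone⟩
      · obtain ⟨F', u', p', V', hprog, hF'w, hF'pos, hS'⟩ := hstep hF hlt.le hS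
        refine ⟨F', u', p', V', hF'pos, hF'w, hS', ?_⟩
        rcases hprog with hTw' | hadv
        · exact Or.inl (hTtw.le.trans hTw')
        · rcases halt with hd | hk
          · exact absurd hd (not_le.2 hlt)
          · right
            push_cast
            linarith
  obtain ⟨k, hk⟩ := exists_nat_gt (Tw / (TP / 2))
  obtain ⟨F, u, p, V, hF, hFw, hS, halt⟩ := hiter k
  have hTtF : Tt ≤ F := by
    rcases halt with hd | hk'
    · exact hd
    · exfalso
      have h2 : Tw < (k : ℝ) * (TP / 2) := by rwa [div_lt_iff₀ (by positivity)] at hk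
      linarith
  exact ⟨u, p, V, hS.1.mono hTt hTtF, hS.2.1.mono le_rfl hTt.le hTtF,
    fun t ht => hS.2.2.1 t ⟨ht.1, ht.2.trans hTtF⟩, hS.2.2.2⟩

/-- The same with the weight order written as the literal `4 = card (Fin 3) + 1` of the route file.
[cite: LemarieRieusset2016, Prop. 12.3 (von Wahl) with Thm. 7.2] -/
theorem exists_fourierMild_four_of_isKatoSolutionOn {ν : ℝ} (hν : 0 < ν)
    {u₀ : EuclideanSpace ℝ (Fin 3) → EuclideanSpace ℝ (Fin 3)} (hsm : ContDiff ℝ ∞ u₀)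
    (hdiv : NSWave0.IsDivFree u₀) (hdec : HasRapidSpatialDecay u₀)
    {T' : ℝ} {w : ℝ → EuclideanSpace ℝ (Fin 3) → EuclideanSpace ℝ (Fin 3)}
    (hw : IsKatoSolutionOn T' ν u₀ w) {T : ℝ} (hT : 0 < T) (hTT' : T < T') :
    ∃ V : ℝ → EuclideanSpace ℝ (Fin 3) → Fin 3 → ℂ,
      IsFourierMild (4 * π ^ 2 * ν) 4 0 T V ∧ V 0 = fourierData hsm hdec := by
  obtain ⟨-, -, V, -, hV, -, hV0⟩ := exists_fourierMild_of_isKatoSolutionOn hν hsm hdiv hdec hw hT hTT'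
  exact ⟨V, Registered.isFourierMild_four hV, hV0⟩

/-- **Global Kato solution ⇒ Fourier-mild solutions of every length.** For a Clay datum with a
global Kato solution (`HasGlobalKatoSolution ν u₀`) and every `T > 0` there is a Fourier-side mild
solution on `[0, T]` from `fourierData hu hd` — the hypothesis of the landed
`Registered.envelopeBound_of_globalMild`, now derived from the Kato currency.
[cite: Kato1984MathZ, Thm. 4] -/
theorem exists_fourierMild_of_hasGlobalKatoSolution {ν : ℝ} (hν : 0 < ν)
    {u₀ : EuclideanSpace ℝ (Fin 3) → EuclideanSpace ℝ (Fin 3)} (hsm : ContDiff ℝ ∞ u₀)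
    (hdiv : NSWave0.IsDivFree u₀) (hdec : HasRapidSpatialDecay u₀)
    (hK : HasGlobalKatoSolution ν u₀) {T : ℝ} (hT : 0 < T) :
    ∃ V : ℝ → EuclideanSpace ℝ (Fin 3) → Fin 3 → ℂ,
      IsFourierMild (4 * π ^ 2 * ν) 4 0 T V ∧ V 0 = fourierData hsm hdec := by
  obtain ⟨w, hw⟩ := hK.exists_isKatoSolutionOn (T + 1)
  exact exists_fourierMild_four_of_isKatoSolutionOn hν hsm hdiv hdec hw hT (by linarith)

/-! ### Registered form -/

/-- **Registered sub-goal `stub_katoFourierSide`** (crux stmt-NavierStokesRegularity-1549, line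
`registered`, lead c5): below a Kato solution of a Clay datum there are Fourier-mild solutions of
every shorter length from `fourierData` — `exists_fourierMild_four_of_isKatoSolutionOn` in the
closed `∀`-form recorded on the ledger. [cite: LemarieRieusset2016, Prop. 12.3 (von Wahl) with Thm. 7.2] -/
theorem stub_katoFourierSide : ∀ ν : ℝ, 0 < ν → ∀ (u₀ : EuclideanSpace ℝ (Fin 3) → EuclideanSpace ℝ (Fin 3)) (hu : ContDiff ℝ (⊤ : ℕ∞) u₀) (hd : Literature.Analysis.FluidPDE.HasRapidSpatialDecay u₀), Literature.Analysis.FluidPDE.NSWave0.IsDivFree u₀ → ∀ (T' : ℝ) (w : ℝ → EuclideanSpace ℝ (Fin 3) → EuclideanSpace ℝ (Fin 3)), Literature.Analysis.FluidPDE.IsKatoSolutionOn T' ν u₀ w → ∀ T : ℝ, 0 < T → T < T' → ∃ V : ℝ → EuclideanSpace ℝ (Fin 3) → Fin 3 → ℂ, Literature.Analysis.FluidPDE.FourierNS.IsFourierMild (4 * Real.pi ^ 2 * ν) 4 0 T V ∧ V 0 = Literature.Analysis.FluidPDE.FourierNS.fourierData hu hd :=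
  fun _ hν _ hu hd hdiv _ _ hw _ hT hTT' =>
    exists_fourierMild_four_of_isKatoSolutionOn hν hu hdiv hd hw hT hTT'

end Summit.NavierStokesRegularity.NavierStokesRegularity.Theorems.EnvelopeBound.Kato

end
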